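import Summits.BirchSwinnertonDyer.BirchSwinnertonDyer.Theses.EisensteinPrimes
import Summits.BirchSwinnertonDyer.BirchSwinnertonDyer.Theorems.EisensteinPrimesMazurMCOnX1RankZeroSecondDescent
import Summits.BirchSwinnertonDyer.Rank1Residual.X2.RankZeroExact
import Summits.BirchSwinnertonDyer.Rank1Residual.X2.IsogenyClassStability
import Literature.NumberTheory.EllipticCurves.ComplexMultiplicationLFunctionIsogenyHoldsProofs
import HarnessLib

/-!
# Crux `MazurMCOnCellB` (stmt-BirchSwinnertonDyer-19033), row A10: the SECOND-LAYER descent door BY THE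
# CRUX'S NAMES — the crux's conclusion `X2.MazurMainConjectureAt` (and Miller's `BSDp`) at BOTH members of
# a `ℚ`-isogenous pair `W ∼ W'` of an X2b cell from PUBLISHED facts + one second-layer certificate READ on `W'`

Cell `bsd-eis` (FULL-BSD rank-≤1 programme D-0033, HOME `run/shared/lean/pub/bsd-eis/`), seat
`bsd-eis-k5-c3` gen 7 (prover), item stmt-BirchSwinnertonDyer-19033 (`--supports`; the item is NOT
closed by this file, the skeleton of record `mudescent` is untouched, the crux stays OPEN class-wide).
Route `route-BirchSwinnertonDyer-EisensteinPrimes` (rung K5), crux 3 = row A10 = corner X2b (`r_an = 0`,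
odd MULTIPLICATIVE Eisenstein `p`, `¬ GVPar`).

WHAT IS RECORDED (pure composition of landed kernel theorems; no new named fact):
* `cellB_pair_of_secondDescent_of_isIsogenous` — for globally minimal `W ∼ W'` over `ℚ` with `ClassX2 W p`
  (`p` odd, `E[p]` reducible, `p ‖ N`) and `r_an(W) = 0`, a second-layer certificate READ on `W'`
  (`#Ш_an(W') = q'` with `ord_p q' ≤ 4`, `Ш(W')[p] ≠ 0`, `Ш(W')[p] ⊆ pШ(W')`) gives
  `(BSDp W p ∧ BSDp W' p) ∧ (X2.MazurMainConjectureAt W p ∧ X2.MazurMainConjectureAt W' p)`: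
  the `BSDp` pair is k5-c5's class-free door
  `EisensteinPrimesMazurMCOnX1RankZeroSecondDescent.bsdp_pair_of_wuthrich_of_casselsTate_of_secondDescent_of_isIsogenous_of_analyticRank_eq_zero`
  (p515407: Cassels–Tate alternating + `Ш[p] ⊆ pШ` ⇒ `p⁴ ∣ #Ш(W')`, Wuthrich 2014 Prop. 21 ⇒ `BSD(W',p)`,
  Cassels ⇒ `BSD(W,p)`), whose side conditions on `W'` (not additive at `p`, Borel image) are DERIVED here
  from `ClassX2 W p` by the isogeny invariance of class X2 (`X2.classX2_iff_of_isIsogenous`); the main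
  conjecture at each member is `X2.mazurMainConjectureAt_of_bsdp_of_red` (Wuthrich 2014 Thm. 16,
  Stein–Wuthrich 2013 Thm. 6.1 with THE canonical heights, GZK, modularity, Greenberg–Stevens — all
  hypotheses BY NAME), with `r_an(W') = r_an(W)` by the PROVED `analyticRank_eq_of_isIsogenous'`
  (Knapp Thm. 11.67).
* `cellB_pair_of_secondDescent_of_isIsogenous'` — the same with the cell predicate `X2.CellB W p` as input.
This is the class-level form of the 36 per-class displays `X2/SecondDescentDisplay<cls>.lean` landed by
this seat (p536147 … p539271): each display = this door + the Vélu isogeny and the kernel facts of its class.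

HONEST FRAMING: nothing booked, no label moves, BSD proved for NO curve; `#Ш_an`, `Ш[p] ≠ 0` and
`Ш[p] ⊆ pШ` are per-class instrument READs (two first-descent engines, ctp3iso ∥ desc3borel);
the crux stays open class-wide. Theorems only; every published input is a hypothesis BY NAME.

References: [Wuthrich2014] Thm. 16 (p. 397), Prop. 21 (p. 400); [SteinWuthrich2013] Thm. 6.1 (p. 20);
[GreenbergStevens1993]; [SilvermanAEC2009] Thm. X.4.14, Cor. VII.7.2; [Cassels1962ArithmeticIV];
[MilneADT2006] Thm. I.6.13, I.7.3; [Knapp1993] Thm. 11.67; [Miller2011LMS] Def. 1.1.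
-/

set_option autoImplicit false
set_option linter.dupNamespace false

namespace Summit.BirchSwinnertonDyer.BirchSwinnertonDyer.Theorems.EisensteinPrimesMazurMCOnCellBSecondDescent

open WeierstrassCurve Summit.BirchSwinnertonDyer.Rank1Residual
  Literature.NumberTheory.EllipticCurves Literature.NumberTheory.EllipticCurves.Rank1Residual
  Literature.NumberTheory.EllipticCurves.Rank1Residual.Typed
  Literature.NumberTheory.EllipticCurves.ModularForms
  Literature.NumberTheory.EllipticCurves.Wuthrich2014 Literature.NumberTheory.EllipticCurves.SteinWuthrich2013
  Summit.BirchSwinnertonDyer.BirchSwinnertonDyer.Theorems.EisensteinPrimesMazurMCOnX1RankZeroSecondDescent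

section Door

variable (W W' : WeierstrassCurve ℚ) [W.IsElliptic] [W.IsGloballyMinimal] [W'.IsElliptic]
  [W'.IsGloballyMinimal] (p : ℕ) [Fact p.Prime]

/-- **The second-layer door of row A10, by the crux's names.** Globally minimal `W ∼ W'` over `ℚ`,
`ClassX2 W p` (`p ≠ 2`, `E[p]` reducible, multiplicative at `p`), `r_an(W) = 0`, and the second-layer
certificate READ on `W'` — `#Ш(W'/ℚ)_an = q'` with `ord_p q' ≤ 4`, a non-trivial element of `Ш(W')[p]`,
and `Ш(W')[p] ⊆ pШ(W')` (the Cassels–Tate pairing vanishes on `Ш(W')[p]`) — give Miller's `BSD(·,p)` AND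
Mazur's main conjecture `X2.MazurMainConjectureAt · p` at BOTH members, from the PUBLISHED facts BY NAME:
Cassels–Tate (`hCT`), Wuthrich 2014 Prop. 21 (`hW`) and Thm. 16 (`hWu`), GZK (`hGZK`), modularity (`hmod`),
Cassels' isogeny invariance (`hCassels`), Stein–Wuthrich 2013 Thm. 6.1 (`hJs hJn`) with THE canonical
heights (`hHs hHn`), Greenberg–Stevens (`hGS`, class-wide shape of the route's `PublishedInputs`).
Chain: class X2 passes to `W'` (`X2.classX2_iff_of_isIsogenous`), so `W'` is multiplicative (not
additive) at `p` with Borel image; k5-c5's door gives the `BSDp` pair; `r_an(W') = 0` by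
`analyticRank_eq_of_isIsogenous'`; `X2.mazurMainConjectureAt_of_bsdp_of_red` at each member.
[cite: Wuthrich2014, Thm. 16 (p. 397) and Prop. 21 (p. 400)] [cite: SteinWuthrich2013, Thm. 6.1 (p. 20)]
[cite: SilvermanAEC2009, Thm. X.4.14 and Cor. VII.7.2] [cite: MilneADT2006, Thm. I.6.13, I.7.3]
[cite: Knapp1993, Thm. 11.67] [cite: GreenbergStevens1993] -/
theorem cellB_pair_of_secondDescent_of_isIsogenous
    (hCT : WeierstrassCurve.exists_casselsTate_pairing (K := ℚ)) (hW : sha_dvd_analyticSha)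
    (hGZK : rank_eq_analyticRank_of_analyticRank_le_one) (hmod : hasEntireLFunction_rat)
    (hCassels : WeierstrassCurve.bsdRHS_eq_of_isIsogenous)
    (hWu : thm16_charIdeal_dvd_multiplicative_of_reducible)
    (hJs : thm61_splitMultiplicative) (hJn : thm61_nonsplitMultiplicative)
    (hHs : exists_isSplitMultCanonical) (hHn : exists_isMultCanonical)
    (hGS : ∀ (V : WeierstrassCurve ℚ) [V.IsElliptic] [V.IsGloballyMinimal] (ℓ : ℕ) [Fact ℓ.Prime],
      greenberg_stevens (W := V) (p := ℓ))
    (hX : ClassX2 W p) (hr : W.analyticRank = 0) (hiso : IsIsogenous W W')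
    {q' : ℚ} (hq' : shaAn W' = (q' : ℂ)) (hv' : padicValRat p q' ≤ 4)
    (hx' : ∃ x : W'.sha, x ≠ 0 ∧ p • x = 0)
    (hdiv' : ∀ x : W'.sha, p • x = 0 → ∃ y : W'.sha, p • y = x) :
    (BSDp W p ∧ BSDp W' p) ∧ (X2.MazurMainConjectureAt W p ∧ X2.MazurMainConjectureAt W' p) := by
  -- class X2 is a property of the isogeny class
  have hX' : ClassX2 W' p := (X2.classX2_iff_of_isIsogenous (p := p) hiso).mp hX
  have hr' : W'.analyticRank = 0 := (analyticRank_eq_of_isIsogenous' hiso).symm.trans hr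
  -- the BSD pair from k5-c5's class-free second-layer door
  have hb : BSDp W p ∧ BSDp W' p :=
    bsdp_pair_of_wuthrich_of_casselsTate_of_secondDescent_of_isIsogenous_of_analyticRank_eq_zero W W' p
      hCT hW hGZK hmod hCassels hiso hX.1 hr
      (WeierstrassCurve.HasMultiplicativeReduction.not_hasAdditiveReduction _ hX'.2.2) (Or.inl hX'.2.1)
      hq' hv' hx' hdiv'
  -- Mazur's main conjecture at each member from its BSDp
  refine ⟨hb, ?_, ?_⟩
  · exact X2.mazurMainConjectureAt_of_bsdp_of_red hWu hJs hJn hHs hHn hGZK hmod W p (hGS W p) hX.1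
      hX.2.2 hX.2.1 hr hb.1
  · exact X2.mazurMainConjectureAt_of_bsdp_of_red hWu hJs hJn hHs hHn hGZK hmod W' p (hGS W' p) hX'.1
      hX'.2.2 hX'.2.1 hr' hb.2

/-- **The same door with the cell predicate as input**: at an X2b pair (`X2.CellB W p`: `r_an = 0`,
`ClassX2`, `¬ GVPar`) and a `ℚ`-isogenous `W'` carrying the second-layer certificate, Mazur's main
conjecture — the conclusion of crux 3 `MazurMCOnCellB` at the pair — and `BSD(·,p)` hold at both members.
(`¬ GVPar` is not used: the road is parity-free.) [cite: Wuthrich2014, Thm. 16 (p. 397) and Prop. 21 (p. 400)]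
[cite: SteinWuthrich2013, Thm. 6.1 (p. 20)] [cite: MilneADT2006, Thm. I.6.13, I.7.3] -/
theorem cellB_pair_of_secondDescent_of_isIsogenous'
    (hCT : WeierstrassCurve.exists_casselsTate_pairing (K := ℚ)) (hW : sha_dvd_analyticSha)
    (hGZK : rank_eq_analyticRank_of_analyticRank_le_one) (hmod : hasEntireLFunction_rat)
    (hCassels : WeierstrassCurve.bsdRHS_eq_of_isIsogenous)
    (hWu : thm16_charIdeal_dvd_multiplicative_of_reducible)
    (hJs : thm61_splitMultiplicative) (hJn : thm61_nonsplitMultiplicative)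
    (hHs : exists_isSplitMultCanonical) (hHn : exists_isMultCanonical)
    (hGS : ∀ (V : WeierstrassCurve ℚ) [V.IsElliptic] [V.IsGloballyMinimal] (ℓ : ℕ) [Fact ℓ.Prime],
      greenberg_stevens (W := V) (p := ℓ))
    (hc : X2.CellB W p) (hiso : IsIsogenous W W')
    {q' : ℚ} (hq' : shaAn W' = (q' : ℂ)) (hv' : padicValRat p q' ≤ 4)
    (hx' : ∃ x : W'.sha, x ≠ 0 ∧ p • x = 0)
    (hdiv' : ∀ x : W'.sha, p • x = 0 → ∃ y : W'.sha, p • y = x) :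
    (X2.MazurMainConjectureAt W p ∧ X2.MazurMainConjectureAt W' p) ∧ (BSDp W p ∧ BSDp W' p) := by
  have h := cellB_pair_of_secondDescent_of_isIsogenous W W' p hCT hW hGZK hmod hCassels hWu hJs hJn hHs
    hHn hGS hc.2.1 hc.1 hiso hq' hv' hx' hdiv'
  exact ⟨h.2, h.1⟩

end Door

end Summit.BirchSwinnertonDyer.BirchSwinnertonDyer.Theorems.EisensteinPrimesMazurMCOnCellBSecondDescent
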